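import Summits.Ventures.CertifiedManyBodySolver.Upper.DWaveSourceOpenClusterCut
import Summits.Ventures.CertifiedManyBodySolver.Upper.DWaveSourceOpenBoxBondForm
import HarnessLib

/-!
# Closed form of the TORUS `d`-wave pair weight `dWaveTorusPairWeight L`

HONEST FRAMING: first certified bounds; not a superconductivity verdict. Nothing here is a number or a row: it is
the torus companion of `Upper/DWaveBoxPairWeightClosedForm.lean` (IRD desk, sr-mbsolver-ird-5) — pin-1's torus pair
weight `A(x,y) = Σ_{e ∈ {0,±e₀,±e₁}} 1[y = x + e on the torus] ĝ_d(e)/√2` (`Upper/DWaveSourceOpenClusterCut.lean`,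
used in `pairField_dWave_eq_sum_bondPair` / `dWaveSourceTorus_eq_sourcedForm`) written WITHOUT the step sum, as the
four signed indicators every reader regenerates: `(1[y = x+e₀] + 1[y = x−e₀] − 1[y = x+e₁] − 1[y = x−e₁])/√2`, valid for
EVERY `L` (for `L ≥ 3` at most one indicator is `1`; for `L = 2` the two directions `±eᵢ` coincide and the weight
honestly doubles, as the tree definition does). The comparison is on `TorusSite 2 L = Fin 2 → ZMod L` through
`FermionTorus.toTorusSite`.
-/

noncomputable section
namespace Summit.Ventures.CertifiedManyBodySolver
open Matrix Finset Literature.Probability.LatticeModels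
open Literature.MathematicalPhysics.QuantumLattice Literature.Barriers.HubbardSuperconductivity HubbardWave0

section TorusClosedForm

variable (L : ℕ) [NeZero L]

/-- The five-step sum `Σ_{e ∈ {0, e₀, −e₀, e₁, −e₁}} f e` written out. [folklore] -/
private theorem sum_insert_unitSteps' (f : Site 2 → ℂ) :
    ∑ e ∈ insert (0 : Site 2) unitSteps, f e =
      f 0 + (f (Pi.single 0 1) + (f (-Pi.single 0 1) + (f (Pi.single 1 1) + f (-Pi.single 1 1)))) := by
  have h01 : (Pi.single 0 1 : Site 2) ≠ -Pi.single 0 1 := fun h => by simpa using congrFun h 0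
  have h02 : (Pi.single 0 1 : Site 2) ≠ Pi.single 1 1 := fun h => by simpa using congrFun h 0
  have h03 : (Pi.single 0 1 : Site 2) ≠ -Pi.single 1 1 := fun h => by simpa using congrFun h 0
  have h12 : (-Pi.single 0 1 : Site 2) ≠ Pi.single 1 1 := fun h => by simpa using congrFun h 0
  have h13 : (-Pi.single 0 1 : Site 2) ≠ -Pi.single 1 1 := fun h => by simpa using congrFun h 0
  have h23 : (Pi.single 1 1 : Site 2) ≠ -Pi.single 1 1 := fun h => by simpa using congrFun h 1
  have hz0 : (0 : Site 2) ≠ Pi.single 0 1 := fun h => by simpa using congrFun h 0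
  have hz1 : (0 : Site 2) ≠ -Pi.single 0 1 := fun h => by simpa using congrFun h 0
  have hz2 : (0 : Site 2) ≠ Pi.single 1 1 := fun h => by simpa using congrFun h 1
  have hz3 : (0 : Site 2) ≠ -Pi.single 1 1 := fun h => by simpa using congrFun h 1
  simp only [unitSteps]
  rw [Finset.sum_insert (by simp [hz0, hz1, hz2, hz3]), Finset.sum_insert (by simp [h01, h02, h03]),
    Finset.sum_insert (by simp [h12, h13]), Finset.sum_insert (by simp [h23]), Finset.sum_singleton]

/-- `ofTorusSite t = y ↔ t = toTorusSite y` (the two comparison maps are inverse). [folklore] -/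
theorem ofTorusSite_eq_iff {d : ℕ} (t : TorusSite d L) (y : FermionTorus d L) :
    FermionTorus.ofTorusSite t = y ↔ t = FermionTorus.toTorusSite y := by
  constructor
  · rintro rfl; exact (FermionTorus.toTorusSite_ofTorusSite t).symm
  · rintro rfl; exact FermionTorus.ofTorusSite_toTorusSite y

omit [NeZero L] in
/-- `Torus.proj` of a unit step is the unit step of the torus. [folklore] -/
theorem Torus_proj_single (i : Fin 2) : Torus.proj L (Pi.single i 1 : Site 2) = (Pi.single i 1 : TorusSite 2 L) := by
  funext j
  by_cases h : j = i
  · subst h; simp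
  · simp [Pi.single_eq_of_ne h]

omit [NeZero L] in
/-- `Torus.proj` of a negative unit step. [folklore] -/
theorem Torus_proj_neg_single (i : Fin 2) : Torus.proj L (-Pi.single i 1 : Site 2) = -(Pi.single i 1 : TorusSite 2 L) := by
  funext j
  by_cases h : j = i
  · subst h; simp
  · simp [Pi.single_eq_of_ne h]

/-- **Closed form of the torus pair weight** (every `L`): `A(x,y) = (1[y = x+e₀] + 1[y = x−e₀] − 1[y = x+e₁] −
1[y = x−e₁])/√2` with the comparisons in `(ℤ/Lℤ)²` through `toTorusSite`. [cite: KomaTasaki1994, §1] -/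
theorem dWaveTorusPairWeight_eq_indicators (x y : FermionTorus 2 L) :
    dWaveTorusPairWeight L (x, y) =
      ((((if FermionTorus.toTorusSite y = FermionTorus.toTorusSite x + Pi.single 0 1 then (1 : ℝ) else 0) +
          (if FermionTorus.toTorusSite y = FermionTorus.toTorusSite x - Pi.single 0 1 then (1 : ℝ) else 0) -
          (if FermionTorus.toTorusSite y = FermionTorus.toTorusSite x + Pi.single 1 1 then (1 : ℝ) else 0) -
          (if FermionTorus.toTorusSite y = FermionTorus.toTorusSite x - Pi.single 1 1 then (1 : ℝ) else 0)) /
          Real.sqrt 2 : ℝ) : ℂ) := by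
  unfold dWaveTorusPairWeight
  rw [sum_insert_unitSteps']
  have hF0 : dWaveFormFactor (Pi.single 0 1) = 1 := by simp [dWaveFormFactor]
  have hF0' : dWaveFormFactor (-Pi.single 0 1) = 1 := by simp [dWaveFormFactor]
  have h1 : (Pi.single 1 1 : Site 2) ≠ Pi.single 0 1 := fun h => by simpa using congrFun h 0
  have h2 : (Pi.single 1 1 : Site 2) ≠ -Pi.single 0 1 := fun h => by simpa using congrFun h 0
  have h3 : (-Pi.single 1 1 : Site 2) ≠ Pi.single 0 1 := fun h => by simpa using congrFun h 0
  have h4 : (-Pi.single 1 1 : Site 2) ≠ -Pi.single 0 1 := fun h => by simpa using congrFun h 1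
  have hF1 : dWaveFormFactor (Pi.single 1 1) = -1 := by simp [dWaveFormFactor, h1, h2]
  have hF1' : dWaveFormFactor (-Pi.single 1 1) = -1 := by simp [dWaveFormFactor, h3, h4]
  simp only [dWaveFormFactor_zero, zero_div, Complex.ofReal_zero, ite_self, zero_add, hF0, hF0', hF1, hF1',
    ofTorusSite_eq_iff, Torus_proj_single, Torus_proj_neg_single, ← sub_eq_add_neg]
  -- four indicators; compare both sides as complex numbers
  simp only [eq_comm (a := FermionTorus.toTorusSite x + Pi.single 0 1), eq_comm (a := FermionTorus.toTorusSite x - Pi.single 0 1),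
    eq_comm (a := FermionTorus.toTorusSite x + Pi.single 1 1), eq_comm (a := FermionTorus.toTorusSite x - Pi.single 1 1)]
  split_ifs <;> (push_cast; ring)

/-- The torus pair weight is symmetric: both orientations of a torus bond carry the same weight
(`y = x + e ↔ x = y − e` in `(ℤ/Lℤ)²`). [cite: KomaTasaki1994, §1] -/
theorem dWaveTorusPairWeight_symm (x y : FermionTorus 2 L) :
    dWaveTorusPairWeight L (y, x) = dWaveTorusPairWeight L (x, y) := by
  rw [dWaveTorusPairWeight_eq_indicators, dWaveTorusPairWeight_eq_indicators]
  have A : ∀ s : TorusSite 2 L, (FermionTorus.toTorusSite x = FermionTorus.toTorusSite y + s) ↔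
      (FermionTorus.toTorusSite y = FermionTorus.toTorusSite x - s) := fun s => by
    constructor
    · intro h; rw [h, add_sub_cancel_right]
    · intro h; rw [h, sub_add_cancel]
  have B : ∀ s : TorusSite 2 L, (FermionTorus.toTorusSite x = FermionTorus.toTorusSite y - s) ↔
      (FermionTorus.toTorusSite y = FermionTorus.toTorusSite x + s) := fun s => by
    constructor
    · intro h; rw [h, sub_add_cancel]
    · intro h; rw [h, add_sub_cancel_right]
  simp only [A, B]
  push_cast
  ring

/-- Off the torus graph the weight vanishes (`L ≥ 2`; for `L = 1` every site coincides and the four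
indicators cancel anyway). [cite: KomaTasaki1994, §1] -/
theorem dWaveTorusPairWeight_eq_zero_of_not_adj [Fact (1 < L)] (x y : FermionTorus 2 L)
    (h : ¬ (torusGraph 2 L).Adj (FermionTorus.toTorusSite x) (FermionTorus.toTorusSite y)) :
    dWaveTorusPairWeight L (x, y) = 0 := by
  rw [dWaveTorusPairWeight_eq_indicators]
  rw [torusGraph_adj_iff] at h
  have hs : ∀ i : Fin 2, (Pi.single i (1 : ZMod L) : TorusSite 2 L) ≠ 0 := fun i hi => by
    have := congrFun hi i
    simp at this
  -- each indicator would give an adjacency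
  have hplus : ∀ i : Fin 2, ¬ FermionTorus.toTorusSite y = FermionTorus.toTorusSite x + Pi.single i 1 := by
    intro i hc
    apply h
    refine ⟨fun hxy => hs i ?_, Or.inl ⟨i, hc⟩⟩
    rw [hxy] at hc
    exact (left_eq_add.mp hc).symm ▸ rfl
  have hminus : ∀ i : Fin 2, ¬ FermionTorus.toTorusSite y = FermionTorus.toTorusSite x - Pi.single i 1 := by
    intro i hc
    apply h
    have hc' : FermionTorus.toTorusSite x = FermionTorus.toTorusSite y + Pi.single i 1 := by
      rw [hc, sub_add_cancel]
    refine ⟨fun hxy => hs i ?_, Or.inr ⟨i, hc'⟩⟩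
    rw [← hxy] at hc'
    exact (left_eq_add.mp hc').symm ▸ rfl
  simp [hplus, hminus]

/-- **The torus source over bonds counted once** (`L ≥ 2`): the ordered-pair source `Σ_{(x,y)} A(x,y) b_{xy}` of
`dWaveSourceTorus_eq_sourcedForm` equals `Σ_{(x,y): x<y} (2·A(x,y)) b_{xy}` — both orientations of a torus bond
carry the same weight (`dWaveTorusPairWeight_symm`) and the same singlet pair operator (`bondPair_swap`), and the
diagonal weight vanishes; with `dWaveTorusPairWeight_eq_indicators`, `2A = ±√2` on torus bonds for `L ≥ 3`.
[cite: KomaTasaki1994, §1] -/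
theorem sum_dWaveTorusPairWeight_smul_bondPair_eq_sum_lt [Fact (1 < L)] :
    (∑ z : FermionTorus 2 L × FermionTorus 2 L, dWaveTorusPairWeight L z • bondPair z.1 z.2) =
      ∑ z : FermionTorus 2 L × FermionTorus 2 L,
        if z.1 < z.2 then (2 * dWaveTorusPairWeight L z) • bondPair z.1 z.2 else 0 := by
  classical
  rw [sum_prod_eq_sum_lt_add_swap (fun z : FermionTorus 2 L × FermionTorus 2 L => dWaveTorusPairWeight L z • bondPair z.1 z.2)
      (fun p => by rw [dWaveTorusPairWeight_eq_zero_of_not_adj L p p (SimpleGraph.irrefl _), zero_smul])]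
  refine Finset.sum_congr rfl fun z _ => ?_
  obtain ⟨x, y⟩ := z
  by_cases h : x < y
  · simp only [h, if_true]
    rw [dWaveTorusPairWeight_symm L x y, bondPair_swap x y, ← add_smul, ← two_mul]
  · simp only [h, if_false]

end TorusClosedForm
end Summit.Ventures.CertifiedManyBodySolver
end
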